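import Mathlib
import Literature.Computability.Complexity.CNF
import Literature.Computability.Complexity.CoinCounting
import Literature.Computability.Complexity.ApproximateCounting
import Literature.Computability.Complexity.LengthCompare
import Literature.Computability.Complexity.CodeFPStrings
import Literature.Computability.Complexity.CodeFPLists
import Literature.Computability.Complexity.CodeFPListKit
import Literature.Computability.Complexity.SumcheckMAReferee
import Summits.PneNP.PneNP.Theses.WitnessForging
import Summits.PneNP.PneNP.Theorems.WitnessForgingSatBridgeDefs
import Summits.PneNP.PneNP.Theorems.WitnessForgingSatBridgeCounts

/-!
# Route WitnessForging — support item `SatBridge` (stmt-PneNP-2432), part 3: the sampler is polynomial time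

The bit-by-bit sampler `samplerJVV` of `WitnessForgingSatBridgeDefs.lean` is computed by a
polynomial-time string function on the codes `⟨enc φ, ω⟩` (`codeFP_samplerJVV`), assembled in the
typed `CodeFP` algebra (`CodeFP*.lean`): the estimate `estOf` (counting query, coin prefix, the
oracle-free transducer `Fst ∈ FP`, `decodeNat` via `canonF`), one round `stepJVV` (three coin
pieces, two estimates, the biased coin), and the whole run as a `CodeFP.foldl` over the coin blocks
(`strChunks`) with a linearly bounded accumulator. No machine is written.

Elaboration note: the intermediate `CodeFP` facts are re-typed with `.congr fun _ => by dsimp only`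
rather than by ascription (definitional unfolding of the large estimator terms is too slow for the
default `isDefEq`).
-/

set_option linter.dupNamespace false -- `Summit.PneNP.PneNP.…`: summit = sub-problem (D-0017)

namespace Summit.PneNP.PneNP.Theorems.SatBridgeJVV

open Literature.Computability.Complexity
open _root_.Computability Polynomial Brick CodeFP
open Literature.Computability.Complexity.SumcheckMA (litE cnfE cnfE_eq)

/-! ### Small typed bricks -/

/-- Reading an arbitrary answer string as a number (`decodeNat`, via the canonical numeral
`canonF`). [folklore] -/
theorem codeFP_decodeNat : CodeFP strE natE decodeNat :=
  CodeFP.of_fn canonF canonF_mem_FP fun w => canonF_eq_encodeNat_decodeNat w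

/-- A string function already in `FP`. [folklore] -/
theorem codeFP_ofFP {G : List Bool → List Bool} (hG : G ∈ FP) : CodeFP strE strE G :=
  CodeFP.of_fn G hG fun _ => rfl

/-- A bit as a one-symbol string. [folklore] -/
theorem codeFP_bitStr : CodeFP bitE strE (fun b : Bool => [b]) := transparent fun _ => rfl

/-- A fixed polynomial on unary numerals. [folklore] -/
theorem codeFP_unPoly (Q : Polynomial ℕ) : CodeFP unE unE (fun n => Q.eval n) :=
  ((SumcheckMA.polyU Q).comp strOfUn).congr fun n => by simp

/-- Truncated double subtraction in unary, capped form: `(n, w) ↦ n - |w| - 1`. [folklore] -/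
theorem codeFP_unSubLenSucc : CodeFP (pairE unE strE) unE (fun p => p.1 - p.2.length - 1) :=
  (unOfNatMin.comp ((CodeFP.fst _ _).pair (natSub.comp ((natOfUn.comp (CodeFP.fst _ _)).pair
    (natAdd.comp ((strNatLength.comp (CodeFP.snd _ _)).pair (CodeFP.const _ 1))))))).congr fun p => by
      simp only [id]
      omega

/-! ### The estimator on codes -/

section Est

variable {Fst : List Bool → List Bool} (hFst : Fst ∈ FP) (c : Polynomial ℕ) (b : Bool)

include hFst in
/-- **The estimate on codes**: `(x, padr, n, k, w, u) ↦ estOf (q ↦ Fst ⟨q, padr⟩) c x n k w b u`.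
[folklore] -/
theorem codeFP_estOf : CodeFP (pairE strE (pairE strE (pairE unE (pairE unE (pairE strE strE))))) natE
    (fun e : List Bool × (List Bool × (ℕ × (ℕ × (List Bool × List Bool)))) =>
      estOf (fun q => Fst (boolPair q e.2.1)) c e.1 e.2.2.1 e.2.2.2.1 e.2.2.2.2.1 b e.2.2.2.2.2) := by
  have ex : CodeFP (pairE strE (pairE strE (pairE unE (pairE unE (pairE strE strE))))) strE (fun e : List Bool × (List Bool × (ℕ × (ℕ × (List Bool × List Bool)))) => e.1) :=
    CodeFP.fst _ _
  have epad : CodeFP (pairE strE (pairE strE (pairE unE (pairE unE (pairE strE strE))))) strE (fun e : List Bool × (List Bool × (ℕ × (ℕ × (List Bool × List Bool)))) => e.2.1) :=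
    (CodeFP.snd _ _).fst'
  have en : CodeFP (pairE strE (pairE strE (pairE unE (pairE unE (pairE strE strE))))) unE (fun e : List Bool × (List Bool × (ℕ × (ℕ × (List Bool × List Bool)))) => e.2.2.1) :=
    (CodeFP.snd _ _).snd'.fst'
  have ek : CodeFP (pairE strE (pairE strE (pairE unE (pairE unE (pairE strE strE))))) unE (fun e : List Bool × (List Bool × (ℕ × (ℕ × (List Bool × List Bool)))) => e.2.2.2.1) :=
    (CodeFP.snd _ _).snd'.snd'.fst'
  have ew : CodeFP (pairE strE (pairE strE (pairE unE (pairE unE (pairE strE strE))))) strE (fun e : List Bool × (List Bool × (ℕ × (ℕ × (List Bool × List Bool)))) => e.2.2.2.2.1) :=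
    (CodeFP.snd _ _).snd'.snd'.snd'.fst'
  have eu : CodeFP (pairE strE (pairE strE (pairE unE (pairE unE (pairE strE strE))))) strE (fun e : List Bool × (List Bool × (ℕ × (ℕ × (List Bool × List Bool)))) => e.2.2.2.2.2) :=
    (CodeFP.snd _ _).snd'.snd'.snd'.snd'
  -- `wb = w ++ [b]`, `x' = ⟨x, wb⟩`
  have ewb : CodeFP (pairE strE (pairE strE (pairE unE (pairE unE (pairE strE strE))))) strE
      (fun e : List Bool × (List Bool × (ℕ × (ℕ × (List Bool × List Bool)))) => e.2.2.2.2.1 ++ [b]) :=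
    strAppend.comp (ew.pair (CodeFP.const _ [b]))
  have ex' : CodeFP (pairE strE (pairE strE (pairE unE (pairE unE (pairE strE strE))))) strE (fun e : List Bool × (List Bool × (ℕ × (ℕ × (List Bool × List Bool)))) =>
      boolPair e.1 (e.2.2.2.2.1 ++ [b])) :=
    (ex.pair ewb).recodeOut fun _ => rfl
  -- `m = n - |w| - 1`
  have em : CodeFP (pairE strE (pairE strE (pairE unE (pairE unE (pairE strE strE))))) unE (fun e : List Bool × (List Bool × (ℕ × (ℕ × (List Bool × List Bool)))) =>
      e.2.2.1 - e.2.2.2.2.1.length - 1) :=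
    codeFP_unSubLenSucc.comp (en.pair ew)
  -- `ℓ = c(|x'| + m + k + k)` and the coin prefix
  have esum : CodeFP (pairE strE (pairE strE (pairE unE (pairE unE (pairE strE strE))))) unE (fun e : List Bool × (List Bool × (ℕ × (ℕ × (List Bool × List Bool)))) =>
      (boolPair e.1 (e.2.2.2.2.1 ++ [b])).length + (e.2.2.1 - e.2.2.2.2.1.length - 1) + e.2.2.2.1 + e.2.2.2.1) :=
    unAdd.comp ((unAdd.comp ((unAdd.comp ((strLength.comp ex').pair em)).pair ek)).pair ek)
  have eℓ : CodeFP (pairE strE (pairE strE (pairE unE (pairE unE (pairE strE strE))))) unE (fun e : List Bool × (List Bool × (ℕ × (ℕ × (List Bool × List Bool)))) =>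
      c.eval ((boolPair e.1 (e.2.2.2.2.1 ++ [b])).length + (e.2.2.1 - e.2.2.2.2.1.length - 1) +
        e.2.2.2.1 + e.2.2.2.1)) :=
    (codeFP_unPoly c).comp esum
  have eu' : CodeFP (pairE strE (pairE strE (pairE unE (pairE unE (pairE strE strE))))) strE (fun e : List Bool × (List Bool × (ℕ × (ℕ × (List Bool × List Bool)))) =>
      e.2.2.2.2.2.take (c.eval ((boolPair e.1 (e.2.2.2.2.1 ++ [b])).length +
        (e.2.2.1 - e.2.2.2.2.1.length - 1) + e.2.2.2.1 + e.2.2.2.1))) :=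
    strTake.comp (eℓ.pair eu)
  -- the counting query `⟨⟨x', ⟨1^m, ⟨1^k, 1^k⟩⟩⟩, u'⟩`
  have eq : CodeFP (pairE strE (pairE strE (pairE unE (pairE unE (pairE strE strE))))) strE (fun e : List Bool × (List Bool × (ℕ × (ℕ × (List Bool × List Bool)))) =>
      countQuery (boolPair e.1 (e.2.2.2.2.1 ++ [b])) (e.2.2.1 - e.2.2.2.2.1.length - 1) e.2.2.2.1 e.2.2.2.1
        (e.2.2.2.2.2.take (c.eval ((boolPair e.1 (e.2.2.2.2.1 ++ [b])).length +
          (e.2.2.1 - e.2.2.2.2.1.length - 1) + e.2.2.2.1 + e.2.2.2.1)))) :=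
    ((ex'.pair (em.pair (ek.pair ek))).pair eu').recodeOut fun _ => rfl
  -- `Fst ⟨q, padr⟩`, read as a number
  have eF : CodeFP (pairE strE (pairE strE (pairE unE (pairE unE (pairE strE strE))))) strE (fun e : List Bool × (List Bool × (ℕ × (ℕ × (List Bool × List Bool)))) =>
      Fst (boolPair (countQuery (boolPair e.1 (e.2.2.2.2.1 ++ [b])) (e.2.2.1 - e.2.2.2.2.1.length - 1)
        e.2.2.2.1 e.2.2.2.1 (e.2.2.2.2.2.take (c.eval ((boolPair e.1 (e.2.2.2.2.1 ++ [b])).length +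
          (e.2.2.1 - e.2.2.2.2.1.length - 1) + e.2.2.2.1 + e.2.2.2.1)))) e.2.1)) :=
    (codeFP_ofFP hFst).comp ((eq.pair epad).recodeOut fun _ => rfl)
  exact (codeFP_decodeNat.comp eF).congr fun e => rfl

end Est

/-! ### One round on codes -/

section Step

variable {Fst : List Bool → List Bool} (hFst : Fst ∈ FP) (c : Polynomial ℕ)

include hFst in
/-- **One round on codes.** [folklore] -/
theorem codeFP_stepJVV : CodeFP (pairE (pairE strE (pairE strE (pairE unE (pairE unE (pairE unE unE))))) (pairE strE strE)) strE
    (fun t : (List Bool × (List Bool × (ℕ × (ℕ × (ℕ × ℕ))))) × (List Bool × List Bool) =>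
      stepJVV (estOf (fun q => Fst (boolPair q t.1.2.1)) c t.1.1 t.1.2.2.1 t.1.2.2.2.1)
        t.1.2.2.2.2.1 t.1.2.2.2.2.2 t.2.2 t.2.1) := by
  have tx : CodeFP (pairE (pairE strE (pairE strE (pairE unE (pairE unE (pairE unE unE))))) (pairE strE strE)) strE
      (fun t : (List Bool × (List Bool × (ℕ × (ℕ × (ℕ × ℕ))))) × (List Bool × List Bool) => t.1.1) :=
    (CodeFP.fst _ _).fst'
  have tpad : CodeFP (pairE (pairE strE (pairE strE (pairE unE (pairE unE (pairE unE unE))))) (pairE strE strE)) strE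
      (fun t : (List Bool × (List Bool × (ℕ × (ℕ × (ℕ × ℕ))))) × (List Bool × List Bool) => t.1.2.1) :=
    (CodeFP.fst _ _).snd'.fst'
  have tn : CodeFP (pairE (pairE strE (pairE strE (pairE unE (pairE unE (pairE unE unE))))) (pairE strE strE)) unE
      (fun t : (List Bool × (List Bool × (ℕ × (ℕ × (ℕ × ℕ))))) × (List Bool × List Bool) => t.1.2.2.1) :=
    (CodeFP.fst _ _).snd'.snd'.fst'
  have tk : CodeFP (pairE (pairE strE (pairE strE (pairE unE (pairE unE (pairE unE unE))))) (pairE strE strE)) unE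
      (fun t : (List Bool × (List Bool × (ℕ × (ℕ × (ℕ × ℕ))))) × (List Bool × List Bool) => t.1.2.2.2.1) :=
    (CodeFP.fst _ _).snd'.snd'.snd'.fst'
  have tU : CodeFP (pairE (pairE strE (pairE strE (pairE unE (pairE unE (pairE unE unE))))) (pairE strE strE)) unE
      (fun t : (List Bool × (List Bool × (ℕ × (ℕ × (ℕ × ℕ))))) × (List Bool × List Bool) => t.1.2.2.2.2.1) :=
    (CodeFP.fst _ _).snd'.snd'.snd'.snd'.fst'
  have tL : CodeFP (pairE (pairE strE (pairE strE (pairE unE (pairE unE (pairE unE unE))))) (pairE strE strE)) unE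
      (fun t : (List Bool × (List Bool × (ℕ × (ℕ × (ℕ × ℕ))))) × (List Bool × List Bool) => t.1.2.2.2.2.2) :=
    (CodeFP.fst _ _).snd'.snd'.snd'.snd'.snd'
  have tblk : CodeFP (pairE (pairE strE (pairE strE (pairE unE (pairE unE (pairE unE unE))))) (pairE strE strE)) strE
      (fun t : (List Bool × (List Bool × (ℕ × (ℕ × (ℕ × ℕ))))) × (List Bool × List Bool) => t.2.1) :=
    (CodeFP.snd _ _).fst'
  have tw : CodeFP (pairE (pairE strE (pairE strE (pairE unE (pairE unE (pairE unE unE))))) (pairE strE strE)) strE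
      (fun t : (List Bool × (List Bool × (ℕ × (ℕ × (ℕ × ℕ))))) × (List Bool × List Bool) => t.2.2) :=
    (CodeFP.snd _ _).snd'
  -- the three coin pieces
  have tu0 : CodeFP (pairE (pairE strE (pairE strE (pairE unE (pairE unE (pairE unE unE))))) (pairE strE strE)) strE
      (fun t : (List Bool × (List Bool × (ℕ × (ℕ × (ℕ × ℕ))))) × (List Bool × List Bool) =>
        t.2.1.take t.1.2.2.2.2.1) :=
    strTake.comp (tU.pair tblk)
  have tu1 : CodeFP (pairE (pairE strE (pairE strE (pairE unE (pairE unE (pairE unE unE))))) (pairE strE strE)) strE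
      (fun t : (List Bool × (List Bool × (ℕ × (ℕ × (ℕ × ℕ))))) × (List Bool × List Bool) =>
        (t.2.1.drop t.1.2.2.2.2.1).take t.1.2.2.2.2.1) :=
    strTake.comp (tU.pair (strDrop.comp (tU.pair tblk)))
  have tv : CodeFP (pairE (pairE strE (pairE strE (pairE unE (pairE unE (pairE unE unE))))) (pairE strE strE)) strE
      (fun t : (List Bool × (List Bool × (ℕ × (ℕ × (ℕ × ℕ))))) × (List Bool × List Bool) =>
        (t.2.1.drop (2 * t.1.2.2.2.2.1)).take t.1.2.2.2.2.2) :=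
    (strTake.comp (tL.pair (strDrop.comp ((unAdd.comp (tU.pair tU)).pair tblk)))).congr fun t => by
      simp only [two_mul]
  have tt : CodeFP (pairE (pairE strE (pairE strE (pairE unE (pairE unE (pairE unE unE))))) (pairE strE strE)) natE
      (fun t : (List Bool × (List Bool × (ℕ × (ℕ × (ℕ × ℕ))))) × (List Bool × List Bool) =>
        bitsToNat ((t.2.1.drop (2 * t.1.2.2.2.2.1)).take t.1.2.2.2.2.2)) :=
    strVal.comp tv
  -- the two estimates
  have tN0 : CodeFP (pairE (pairE strE (pairE strE (pairE unE (pairE unE (pairE unE unE))))) (pairE strE strE)) natE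
      (fun t : (List Bool × (List Bool × (ℕ × (ℕ × (ℕ × ℕ))))) × (List Bool × List Bool) =>
        estOf (fun q => Fst (boolPair q t.1.2.1)) c t.1.1 t.1.2.2.1 t.1.2.2.2.1 t.2.2 false
          (t.2.1.take t.1.2.2.2.2.1)) :=
    ((codeFP_estOf hFst c false).comp (tx.pair (tpad.pair (tn.pair (tk.pair (tw.pair tu0)))))).congr
      fun t => by dsimp only
  have tN1 : CodeFP (pairE (pairE strE (pairE strE (pairE unE (pairE unE (pairE unE unE))))) (pairE strE strE)) natE
      (fun t : (List Bool × (List Bool × (ℕ × (ℕ × (ℕ × ℕ))))) × (List Bool × List Bool) =>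
        estOf (fun q => Fst (boolPair q t.1.2.1)) c t.1.1 t.1.2.2.1 t.1.2.2.2.1 t.2.2 true
          ((t.2.1.drop t.1.2.2.2.2.1).take t.1.2.2.2.2.1)) :=
    ((codeFP_estOf hFst c true).comp (tx.pair (tpad.pair (tn.pair (tk.pair (tw.pair tu1)))))).congr
      fun t => by dsimp only
  -- the biased coin
  have tbit : CodeFP (pairE (pairE strE (pairE strE (pairE unE (pairE unE (pairE unE unE))))) (pairE strE strE)) bitE
      (fun t : (List Bool × (List Bool × (ℕ × (ℕ × (ℕ × ℕ))))) × (List Bool × List Bool) =>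
        choiceBit
          (estOf (fun q => Fst (boolPair q t.1.2.1)) c t.1.1 t.1.2.2.1 t.1.2.2.2.1 t.2.2 false
            (t.2.1.take t.1.2.2.2.2.1))
          (estOf (fun q => Fst (boolPair q t.1.2.1)) c t.1.1 t.1.2.2.1 t.1.2.2.2.1 t.2.2 true
            ((t.2.1.drop t.1.2.2.2.2.1).take t.1.2.2.2.2.1))
          t.1.2.2.2.2.2 (bitsToNat ((t.2.1.drop (2 * t.1.2.2.2.2.1)).take t.1.2.2.2.2.2))) :=
    (natLt.comp ((natMul.comp (tt.pair (natAdd.comp (tN0.pair tN1)))).pair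
      (natMul.comp (tN1.pair (natPow.comp ((CodeFP.const _ 2).pair tL)))))).congr fun t => by
        dsimp only [choiceBit]
  exact (strAppend.comp (tw.pair (codeFP_bitStr.comp tbit))).congr fun t => by dsimp only [stepJVV]

end Step

/-! ### The sampler on codes -/

/-- The length of the accumulator of the fold is the number of rounds. [folklore] -/
theorem length_foldl_stepJVV (est : List Bool → Bool → List Bool → ℕ) (U L : ℕ) (l : List (List Bool))
    (w : List Bool) : (l.foldl (stepJVV est U L) w).length = w.length + l.length := by
  induction l generalizing w with
  | nil => simp
  | cons a l ih => rw [List.foldl_cons, ih]; simp [stepJVV]; omega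

/-- **The sampler is polynomial time on codes**: for `Fst ∈ FP` and polynomials `c, kk, L, P, T, U`,
the map `(φ, ω) ↦ samplerJVV Fst c kk L P T U (enc φ) (min (numVars φ) |enc φ|) ω` is computed by a
polynomial-time string function on the codes `⟨enc φ, ω⟩`. [cite: JerrumValiantVazirani1986, §3] -/
theorem codeFP_samplerJVV {Fst : List Bool → List Bool} (hFst : Fst ∈ FP) (c kk L P T U : Polynomial ℕ) :
    CodeFP (pairE cnfE strE) strE (fun a : CNF ℕ × List Bool =>
      samplerJVV Fst c kk L P T U (encodingCNF.encode a.1)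
        (min a.1.numVars (encodingCNF.encode a.1).length) a.2) := by
  -- the pieces read off the input `(φ, ω)`
  have hx : CodeFP (pairE cnfE strE) strE (fun a : CNF ℕ × List Bool => cnfE a.1) :=
    (transparent (fun _ => rfl) : CodeFP cnfE strE cnfE).comp (CodeFP.fst _ _)
  have hω : CodeFP (pairE cnfE strE) strE (fun a : CNF ℕ × List Bool => a.2) := CodeFP.snd _ _
  have hpoly : ∀ Q : Polynomial ℕ,
      CodeFP (pairE cnfE strE) unE (fun a : CNF ℕ × List Bool => Q.eval (cnfE a.1).length) := fun Q =>
    (SumcheckMA.polyU Q).comp hx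
  have hn : CodeFP (pairE cnfE strE) unE
      (fun a : CNF ℕ × List Bool => min a.1.numVars (cnfE a.1).length) :=
    unOfNatMin.comp ((strLength.comp hx).pair ((by
      have h := Expander.E3LC.numVarsFP
      unfold Expander.E3LC.cnfE at h
      exact h : CodeFP cnfE natE CNF.numVars).comp (CodeFP.fst _ _)))
  have hr : CodeFP (pairE cnfE strE) strE
      (fun a : CNF ℕ × List Bool => a.2.take (T.eval (cnfE a.1).length)) :=
    strTake.comp ((hpoly T).pair hω)
  have hpad : CodeFP (pairE cnfE strE) strE (fun a : CNF ℕ × List Bool =>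
      boolPair (unaryEncodeNat (P.eval (cnfE a.1).length)) (a.2.take (T.eval (cnfE a.1).length))) :=
    ((strOfUn.comp (hpoly P)).pair hr).recodeOut fun _ => rfl
  have hβ : CodeFP (pairE cnfE strE) strE
      (fun a : CNF ℕ × List Bool => a.2.drop (T.eval (cnfE a.1).length)) :=
    strDrop.comp ((hpoly T).pair hω)
  have hBk : CodeFP (pairE cnfE strE) unE
      (fun a : CNF ℕ × List Bool => 2 * U.eval (cnfE a.1).length + L.eval (cnfE a.1).length) :=
    (unAdd.comp ((unAdd.comp ((hpoly U).pair (hpoly U))).pair (hpoly L))).congr fun a => by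
      simp only [two_mul]
  have hblocks : CodeFP (pairE cnfE strE) (rawE strE) (fun a : CNF ℕ × List Bool =>
      (List.range (cnfE a.1).length).map fun i =>
        ((a.2.drop (T.eval (cnfE a.1).length)).drop
          (i * (2 * U.eval (cnfE a.1).length + L.eval (cnfE a.1).length))).take
          (2 * U.eval (cnfE a.1).length + L.eval (cnfE a.1).length)) :=
    strChunks.comp ((strLength.comp hx).pair (hBk.pair hβ))
  have htake : CodeFP (pairE cnfE strE) (rawE strE) (fun a : CNF ℕ × List Bool =>
      ((List.range (cnfE a.1).length).map fun i =>
        ((a.2.drop (T.eval (cnfE a.1).length)).drop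
          (i * (2 * U.eval (cnfE a.1).length + L.eval (cnfE a.1).length))).take
          (2 * U.eval (cnfE a.1).length + L.eval (cnfE a.1).length)).take
        (min a.1.numVars (cnfE a.1).length)) :=
    (rawTakeUn strE).comp (hn.pair hblocks)
  -- the context of the fold
  have hctx : CodeFP (pairE cnfE strE) (pairE strE (pairE strE (pairE unE (pairE unE (pairE unE unE))))) (fun a : CNF ℕ × List Bool =>
      (cnfE a.1, (boolPair (unaryEncodeNat (P.eval (cnfE a.1).length)) (a.2.take (T.eval (cnfE a.1).length)),
        (min a.1.numVars (cnfE a.1).length, (kk.eval (cnfE a.1).length,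
          (U.eval (cnfE a.1).length, L.eval (cnfE a.1).length)))))) :=
    hx.pair (hpad.pair (hn.pair ((hpoly kk).pair ((hpoly U).pair (hpoly L)))))
  -- the fold
  have hfold := CodeFP.foldl (σ := List Bool × (List Bool × (ℕ × (ℕ × (ℕ × ℕ))))) (α := List Bool)
    (β := List Bool) (eσ := (pairE strE (pairE strE (pairE unE (pairE unE (pairE unE unE)))))) (eα := strE) (eβ := strE)
    (step := fun s blk w => stepJVV (estOf (fun q => Fst (boolPair q s.2.1)) c s.1 s.2.2.1 s.2.2.2.1)
      s.2.2.2.2.1 s.2.2.2.2.2 w blk)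
    (init := fun _ => []) (codeFP_stepJVV hFst c) (CodeFP.const _ []) X (fun s l₁ l₂ => by
      rw [eval_X, pairE_apply, length_boolPair]
      have h1 : ∀ (est : List Bool → Bool → List Bool → ℕ) (U' L' : ℕ),
          (l₁.foldl (fun b a => stepJVV est U' L' b a) []).length = l₁.length := fun est U' L' => by
        have := length_foldl_stepJVV est U' L' l₁ []
        simpa using this
      simp only [id]
      rw [h1]
      have h2 := length_le_length_rawE strE (l₁ ++ l₂)
      rw [List.length_append] at h2
      omega)
  refine ((hfold.comp (hctx.pair htake)).congr fun a => ?_)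
  simp only [samplerJVV, runJVV, cnfE_eq]

end Summit.PneNP.PneNP.Theorems.SatBridgeJVV
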